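import Summits.BirchSwinnertonDyer.BirchSwinnertonDyer.Theorems.GenusKolyvaginAtTwoEquivariantChebotarevAtTwoSigned
import Summits.BirchSwinnertonDyer.BirchSwinnertonDyer.Theorems.GenusKolyvaginAtTwoEquivariantChebotarevAtTwoCriterion
import Literature.GroupTheory.FiniteAbelian.TwoRayCharacter
import Literature.GroupTheory.FiniteAbelian.IndependentGenerators

/-!
# Route `GenusKolyvaginAtTwo`, LINE 6 of crux `KolyvaginExactAtTwo` (22137), key child Q3′
# (stmt-BirchSwinnertonDyer-24882): Cor. 3.2 and Prop. 3.1 (kernel form, TWO RAYS) at `p = 2` for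
# VISIBLE spans — the Čebotarev inputs of the visible pair descent, `K_λ`-currency (helper, PROVED;
# seat `bsd-line-gk2-p2` g10)

The visible pair descent (`Literature/…/HeegnerPointsKolyvaginVisibleDescent*`, this seat) asks
Čebotarev only for spans `C = ⟨c_1, …, c_r⟩ ⊆ H¹(K, E[2^M])` on which restriction to `K(E[2^M])`
is injective — the single hypothesis `hvis : (∀ ρ ∈ Γ_{K(E[2^M])}, [∑ aᵢcᵢ, ρ] = 0) ⟹ ∑ aᵢcᵢ = 0`
(for an independent family: McCallum's independence ∧ the binder `hres` of Q5R, p625098). On the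
habitat of LINE 6 (`Δ(E) < 0`, `K ≠ ℚ(√Δ_E)`, `ρ_{E,2^∞}` onto, non-CM), UNCONDITIONALLY:
* `equivariantChebotarevAtTwo_visible_of_not_isSquare` — Cor. 3.2 at `2` for `c_*`-eigenclasses with
  `hvis` in place of (independence ∧ `hres`): the `cebotarev` field of
  `KolyvaginDescent.VisiblePairHypothesesM` (p632473) in `K_λ`-currency;
* `exists_kolyvaginPrime_two_rays_of_not_isSquare` — **Prop. 3.1 in kernel form on TWO RAYS** for a
  visible span and two indices `i₁, i₂`: a Kolyvagin prime `ℓ > b` with `c_{i,λ} = 0` (`i ≠ i₁, i₂`)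
  and `2^j c_{k,λ} = 0 ⟺ 2^j c_k ∈ ⟨c_i : i ≠ i₁, i₂⟩` (`k = i₁, i₂`) — the visible telescope's
  `hCeb` (p632690). Proof: a basis of `C` (`exists_indep_generators`), the two-ray character
  `χ : C → ℝ/ℤ` (`exists_addMonoidHom_unitAddCircle_two_rays`, p634430), integer targets
  `coefᵢ/2^M = χ(xsᵢ)`, the character form of Step B (p627207) and the criterion (p627418).
Transfer `K_λ → ℚ_ℓ`: seat gk2-p3's `SelmerDescent.zsmul_mem_torsionLocalKer_iff_resTorsion`.
Helper (`--supports` 24882), closes nothing; 0 sorry, standard axioms. BSD is not proved by this.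

References: [McCallumLMS1991] §3 (2)–(3), Prop. 3.1, Cor. 3.2, §5 (21)–(23); [GrossLMS1991] §9;
[Kolyvagin1989Izv] §3.
-/

set_option autoImplicit false
set_option linter.dupNamespace false

noncomputable section

open scoped Classical Pointwise

namespace Summit.BirchSwinnertonDyer.BirchSwinnertonDyer.Theorems.GenusExact

open WeierstrassCurve NumberField IsDedekindDomain Field Finset
open Literature.NumberTheory.GaloisRepresentations Literature.NumberTheory.EllipticCurves
open Literature.NumberTheory Literature.GroupTheory.FiniteAbelian
open Rat.HeightOneSpectrum
open Summit.BirchSwinnertonDyer.BirchSwinnertonDyer.Theorems.KolyvaginEigenTwo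
  (exists_twoTorsion_smul_ne_of_Δ_neg)

/-! ### §1 Cor. 3.2 at `2` for a VISIBLE family of eigenclasses -/

/-- **Cor. 3.2 at `p = 2` for a visible family of `c_*`-eigenclasses.** The binders of
`equivariantChebotarevAtTwo_eigen_of_not_isSquare` with the pair (independence, `hres`) replaced by
the single VISIBILITY hypothesis `hvis`: a relation among the `c_i` that holds after restriction to
`Γ_{K(E[2^M])}` is trivial termwise. This is the `cebotarev` field of the visible pair descent
(`KolyvaginDescent.VisiblePairHypothesesM`, restriction maps `rK₁ + rK₂`) in `K_λ`-currency.
[cite: McCallumLMS1991, §3 Cor. 3.2, p. 299] [cite: Kolyvagin1989Izv, §3] -/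
theorem equivariantChebotarevAtTwo_visible_of_not_isSquare
    (N : ℕ) [NeZero N] (W : WeierstrassCurve ℚ) [W.IsElliptic] [W.IsGloballyMinimal]
    (hcm : ¬ W.HasCM) (hΔ : W.Δ < 0) (K : Type) [Field K] [NumberField K]
    (hK : IsImaginaryQuadratic K) (hns : ¬ IsSquare ((NumberField.discr K : ℚ) * -|W.Δ|))
    (hρ : ∀ n : ℕ, W.HasSurjectiveModNGaloisRep (2 ^ n : ℕ)) (c : K ≃ₐ[ℚ] K) (hc : c ≠ 1)
    (M : ℕ) (hM : 1 ≤ M) (r : ℕ) (cs : Fin r → galH1Torsion (W.baseChange K) ((2 ^ M : ℕ) : ℤ))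
    (sgn : Fin r → ℤ) (hsgn : ∀ i, sgn i = 1 ∨ sgn i = -1) (h0 : ∀ i, cs i ≠ 0)
    (hτs : ∀ i, conjAct W c ((2 ^ M : ℕ) : ℤ) (cs i) = sgn i • cs i)
    (hvis : ∀ a : Fin r → ℤ, (∀ ρ ∈ torsionFixing (W.baseChange K) ((2 ^ M : ℕ) : ℤ),
      h1Eval (W.baseChange K) ((2 ^ M : ℕ) : ℤ) (∑ i, a i • cs i) ρ = 0) → ∀ i, a i • cs i = 0)
    (Mi : Fin r → ℕ) (hMi : ∀ i, addOrderOf (cs i) = 2 ^ Mi i) (Nv : Fin r → ℕ)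
    (hNe : ∀ i, Nv i ≤ Mi i) :
    Set.Infinite {ℓ : ℕ | FrobEqFrobInfty W K (2 ^ M) ℓ ∧ Zhang2014.IsKolyvaginPrime N W K 2 ℓ ∧
      M ≤ Zhang2014.kolyvaginIndex W 2 ℓ ∧
      ∀ i, ∀ v : HeightOneSpectrum (𝓞 K), (ℓ : 𝓞 K) ∈ v.asIdeal → ∀ j : ℕ,
        ((2 ^ j : ℕ) : ℤ) • cs i ∈
            (W.baseChange K).torsionLocalKer (v.adicCompletion K) ((2 ^ M : ℕ) : ℤ) ↔ Nv i ≤ j} := by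
  have hind : ∀ a : Fin r → ℤ, ∑ i, a i • cs i = 0 → ∀ i, (addOrderOf (cs i) : ℤ) ∣ a i := by
    intro a ha i
    rw [addOrderOf_dvd_iff_zsmul_eq_zero]
    exact hvis a (fun ρ hρ ↦ by rw [ha, h1Eval_zero _ _ hρ]) i
  have hres : ∀ a : Fin r → ℤ, (∀ ρ ∈ torsionFixing (W.baseChange K) ((2 ^ M : ℕ) : ℤ),
      h1Eval (W.baseChange K) ((2 ^ M : ℕ) : ℤ) (∑ i, a i • cs i) ρ = 0) → ∑ i, a i • cs i = 0 :=
    fun a ha ↦ Finset.sum_eq_zero fun i _ ↦ hvis a ha i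
  exact equivariantChebotarevAtTwo_eigen_of_not_isSquare N W hcm hΔ K hK hns hρ c hc M hM r cs sgn
    hsgn h0 hτs hind hres Mi hMi Nv hNe

/-! ### §2 Plumbing: the span of finitely many classes is finite; `ℝ/ℤ`-values of `2^M`-torsion -/

section Plumbing

variable {V : Type*} [AddCommGroup V]

/-- The span of finitely many classes killed by `q ≠ 0` is finite (it is the image of the finite
set of coefficient vectors modulo `q`). [folklore] -/
theorem finite_closure_range_of_zsmul_eq_zero {m : ℕ} (gens : Fin m → V) {q : ℕ} (hq : q ≠ 0)
    (hkill : ∀ v : V, (q : ℤ) • v = 0) :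
    (AddSubgroup.closure (Set.range gens) : Set V).Finite := by
  classical
  set f : (Fin m → Fin q) → V := fun a ↦ ∑ i, ((a i : ℕ) : ℤ) • gens i with hf
  refine (Set.finite_range f).subset fun v hv ↦ ?_
  obtain ⟨a, rfl⟩ := AddSubgroup.exists_of_mem_closure_range gens v hv
  haveI : NeZero q := ⟨hq⟩
  refine ⟨fun i ↦ ⟨(a i).natMod q, Int.natMod_lt hq⟩, ?_⟩
  simp only [hf]
  refine Finset.sum_congr rfl fun i _ ↦ ?_
  -- `a i ≡ natMod` modulo `q`, and `q` kills `gens i`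
  have hdecomp : a i = (q : ℤ) * (a i / q) + (((a i).natMod q : ℕ) : ℤ) := by
    rw [Int.natMod, Int.toNat_of_nonneg (Int.emod_nonneg _ (by exact_mod_cast hq))]
    exact (Int.mul_ediv_add_emod (a i) q).symm
  conv_rhs => rw [hdecomp, add_smul, mul_comm, mul_smul, hkill, smul_zero, zero_add]

/-- An element of the span of `gens` is a `ℤ`-combination of the `gens i`. [folklore] -/
theorem exists_sum_eq_of_mem_closure_range {m : ℕ} (gens : Fin m → V) {v : V}
    (hv : v ∈ AddSubgroup.closure (Set.range gens)) : ∃ a : Fin m → ℤ, ∑ i, a i • gens i = v := by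
  obtain ⟨a, ha⟩ := AddSubgroup.exists_of_mem_closure_range gens v hv
  exact ⟨a, ha.symm⟩

/-- A `2^M`-torsion value of `ℝ/ℤ` is `m / 2^M` for a natural number `m`. [folklore] -/
theorem exists_coe_div_eq_of_nsmul_eq_zero {M : ℕ} {u : UnitAddCircle} (hu : (2 ^ M) • u = 0) :
    ∃ m : ℕ, (((m : ℝ) / ((2 ^ M : ℕ) : ℝ)) : UnitAddCircle) = u := by
  obtain ⟨m, -, hm⟩ := (AddCircle.nsmul_eq_zero_iff (pow_pos (by norm_num) M)).mp hu
  exact ⟨m, by rw [mul_one] at hm; exact_mod_cast hm⟩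

/-- `(A / 2^M : ℝ) = 0` in `ℝ/ℤ` iff `2^M ∣ A`. [folklore] -/
theorem coe_div_eq_zero_iff_dvd {M : ℕ} (A : ℤ) :
    (((A : ℝ) / ((2 ^ M : ℕ) : ℝ)) : UnitAddCircle) = 0 ↔ (2 : ℤ) ^ M ∣ A := by
  rw [AddCircle.coe_eq_zero_iff]
  have hpos : (0 : ℝ) < ((2 ^ M : ℕ) : ℝ) := by positivity
  constructor
  · rintro ⟨n, hn⟩
    rw [zsmul_eq_mul, mul_one, eq_div_iff hpos.ne'] at hn
    refine ⟨n, ?_⟩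
    have : (A : ℝ) = ((n * 2 ^ M : ℤ) : ℝ) := by push_cast; push_cast at hn; linarith
    have := Int.cast_injective (α := ℝ) this
    rw [this, mul_comm]
  · rintro ⟨n, rfl⟩
    refine ⟨n, ?_⟩
    rw [zsmul_eq_mul, mul_one, eq_div_iff hpos.ne']
    push_cast
    ring

end Plumbing

/-! ### §3 Prop. 3.1 in kernel form on TWO RAYS at `2`, for a visible span -/

set_option maxHeartbeats 1600000 in
/-- **McCallum's Prop. 3.1 in kernel form at `p = 2`, two rays, visible span.** `c_1, …, c_m` are
`c_*`-eigenclasses in `H¹(K, E[2^M])` whose span `C` is VISIBLE (`hvis`); `C₀ = ⟨c_i : i ≠ i₁, i₂⟩`.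
Above every bound there is a Kolyvagin prime `ℓ` at `2` (`Frob ℓ = Frob ∞` on `K(E[2^M])`, Zhang's
form, `M ≤ M(ℓ)`) with, at `λ ∋ ℓ`: `c_{i,λ} = 0` for `i ≠ i₁, i₂`, and on the two rays
`2^j c_{k,λ} = 0 ⟺ 2^j c_k ∈ C₀`. (Basis of `C`; two-ray character `χ : C → ℝ/ℤ` killing `C₀`;
targets `coefᵢ/2^M = χ(xsᵢ)` realised by a Galois element; the criterion turns
`[g, Frob] = 0 ⟺ χ(g) = 0` into the local statement for the pure classes `2^j c_k`, `c_i`.)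
[cite: McCallumLMS1991, Prop. 3.1 with §3 (2)–(3); §5 (21)–(23)] [cite: GrossLMS1991, §9] -/
theorem exists_kolyvaginPrime_two_rays_of_not_isSquare
    (N : ℕ) [NeZero N] (W : WeierstrassCurve ℚ) [W.IsElliptic] [W.IsGloballyMinimal]
    (_hcm : ¬ W.HasCM) (hΔ : W.Δ < 0) (K : Type) [Field K] [NumberField K]
    (hK : IsImaginaryQuadratic K) (hns : ¬ IsSquare ((NumberField.discr K : ℚ) * -|W.Δ|))
    (hρ : ∀ n : ℕ, W.HasSurjectiveModNGaloisRep (2 ^ n : ℕ)) (c : K ≃ₐ[ℚ] K) (hc : c ≠ 1)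
    (M : ℕ) (hM : 1 ≤ M) {m : ℕ}
    (gens : Fin m → galH1Torsion (W.baseChange K) ((2 ^ M : ℕ) : ℤ))
    (sgn : Fin m → ℤ) (hsgn : ∀ i, sgn i = 1 ∨ sgn i = -1)
    (hτs : ∀ i, conjAct W c ((2 ^ M : ℕ) : ℤ) (gens i) = sgn i • gens i)
    (hvis : ∀ a : Fin m → ℤ, (∀ ρ ∈ torsionFixing (W.baseChange K) ((2 ^ M : ℕ) : ℤ),
      h1Eval (W.baseChange K) ((2 ^ M : ℕ) : ℤ) (∑ i, a i • gens i) ρ = 0) →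
      ∑ i, a i • gens i = 0)
    (i₁ i₂ : Fin m) (b : ℕ) :
    ∃ ℓ : ℕ, b < ℓ ∧ FrobEqFrobInfty W K (2 ^ M) ℓ ∧ Zhang2014.IsKolyvaginPrime N W K 2 ℓ ∧
      M ≤ Zhang2014.kolyvaginIndex W 2 ℓ ∧
      (∀ i, i ≠ i₁ → i ≠ i₂ → ∀ v : HeightOneSpectrum (𝓞 K), (ℓ : 𝓞 K) ∈ v.asIdeal →
        gens i ∈ (W.baseChange K).torsionLocalKer (v.adicCompletion K) ((2 ^ M : ℕ) : ℤ)) ∧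
      ∀ k, (k = i₁ ∨ k = i₂) → ∀ v : HeightOneSpectrum (𝓞 K), (ℓ : 𝓞 K) ∈ v.asIdeal → ∀ j : ℕ,
        (((2 : ℤ) ^ j) • gens k ∈
            (W.baseChange K).torsionLocalKer (v.adicCompletion K) ((2 ^ M : ℕ) : ℤ) ↔
          ((2 : ℤ) ^ j) • gens k ∈
            AddSubgroup.closure (gens '' {i | i ≠ i₁ ∧ i ≠ i₂})) := by
  classical
  haveI : Fact (Nat.Prime 2) := ⟨Nat.prime_two⟩
  have h2n : (2 : ℤ) ∣ ((2 ^ M : ℕ) : ℤ) := by rw [Nat.cast_pow]; exact dvd_pow_self _ (by omega)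
  -- ### the image inputs and a complex conjugation with its free generator (Q1 on `Δ < 0`)
  have hsurj : W.HasSurjectiveModNGaloisRep 2 := by simpa using hρ 1
  have habs : -|W.Δ| = W.Δ := by rw [abs_of_neg hΔ, neg_neg]
  rw [habs] at hns
  obtain ⟨hS, hCe⟩ := image_two_of_not_isSquare W K hK.1 hsurj hns
  obtain ⟨c₀, hc₀⟩ := exists_isComplexConjugation (Rat.castHom ℝ)
  obtain ⟨v₂, hv₂⟩ := exists_twoTorsion_smul_ne_of_Δ_neg W hΔ hc₀
  have hv2 : (2 : ℤ) • (v₂ : geomPoints W) = 0 :=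
    (mem_geomTorsion_iff W 2 (v₂ : geomPoints W)).mp v₂.2
  have hcv : c₀ • (v₂ : geomPoints W) ≠ (v₂ : geomPoints W) := fun h ↦ hv₂ (Subtype.ext h)
  have hq0 : (((2 ^ (M - 1) : ℕ) : ℤ)) ≠ 0 := by positivity
  obtain ⟨P, hP⟩ := W.zsmul_geomPoints_surjective_of_charZero hq0 (v₂ : geomPoints W)
  have hPv : ((2 ^ (M - 1) : ℕ) : ℤ) • P = (v₂ : geomPoints W) := hP
  have hPM₀ : P ∈ geomTorsion W ((2 ^ M : ℕ) : ℤ) := by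
    rw [mem_geomTorsion_iff]
    have h2M : ((2 ^ M : ℕ) : ℤ) = 2 * ((2 ^ (M - 1) : ℕ) : ℤ) := by
      push_cast
      rw [← pow_succ', Nat.sub_add_cancel hM]
    rw [h2M, mul_smul, hPv, hv2]
  set P₀ : geomTorsion W ((2 ^ M : ℕ) : ℤ) := ⟨P, hPM₀⟩ with hP₀
  have hfree₀ : ∀ a b : ℤ, a • P₀ + b • (c₀ • P₀) = 0 → (2 : ℤ) ^ M ∣ a ∧ (2 : ℤ) ^ M ∣ b := by
    intro a b' hab
    have hab' : a • P + b' • (c₀ • P) = 0 := congrArg Subtype.val hab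
    have hPM' : (2 : ℤ) ^ M • P = 0 := by
      have h := (mem_geomTorsion_iff W _ P).mp hPM₀
      push_cast at h
      exact h
    have hPv' : (2 : ℤ) ^ (M - 1) • P = (v₂ : geomPoints W) := by
      have h := hPv
      push_cast at h
      exact h
    exact pow_dvd_of_zsmul_add_zsmul_smul_eq_zero hv2 hcv M P hPM' hPv' a b' hab'
  -- ### the involutive lift of `c` and the free generator on `E(K̄)[2^M]`
  set t : AlgebraicClosure K ≃+* AlgebraicClosure K :=
    (absGaloisTransport (K := ℚ) (L := K) c₀).toRingEquiv with ht_def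
  have ht : IsLiftOfAut c t :=
    RatClosure.isLiftOfAut_absGaloisTransport_of_isImaginaryQuadratic hK hc hc₀
  have hinv : ∀ x, t (t x) = x := fun x ↦
    RatClosure.absGaloisTransport_absGaloisTransport_of_sq_eq_one hc₀.sq_eq_one x
  set θ := RatClosure.torsionEquiv (K := K) W ((2 ^ M : ℕ) : ℤ) with hθ
  have hθc : ht.torsionMap W ((2 ^ M : ℕ) : ℤ) (θ P₀) = θ (c₀ • P₀) := by
    rw [← RatClosure.torsionEquiv_smul_of_lift W ht c₀ (fun _ ↦ rfl) _ P₀]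
  have hPM : (2 : ℤ) ^ M • θ P₀ = 0 := by
    apply Subtype.ext
    rw [AddSubgroupClass.coe_zsmul, ZeroMemClass.coe_zero]
    have := (mem_geomTorsion_iff (W.baseChange K) _
      ((θ P₀ : geomTorsion (W.baseChange K) _) : geomPoints (W.baseChange K))).mp (θ P₀).2
    exact_mod_cast this
  have hfree : ∀ a b : ℤ, a • θ P₀ + b • ht.torsionMap W ((2 ^ M : ℕ) : ℤ) (θ P₀) = 0 →
      (2 : ℤ) ^ M ∣ a ∧ (2 : ℤ) ^ M ∣ b := by
    intro a b' hab
    rw [hθc, ← map_zsmul, ← map_zsmul, ← map_add, map_eq_zero_iff _ θ.injective] at hab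
    exact hfree₀ a b' hab
  have hAP : ∀ A : ℤ, A • θ P₀ = 0 ↔ (2 : ℤ) ^ M ∣ A := by
    intro A
    refine ⟨fun h ↦ (hfree A 0 (by rw [h, zero_smul, add_zero])).1, fun ⟨n, hn⟩ ↦ ?_⟩
    rw [hn, mul_comm, mul_smul, hPM, smul_zero]
  -- ### the span `C`, finite, with a basis `xs`
  set C : AddSubgroup (galH1Torsion (W.baseChange K) ((2 ^ M : ℕ) : ℤ)) :=
    AddSubgroup.closure (Set.range gens) with hC
  have hkill : ∀ z : galH1Torsion (W.baseChange K) ((2 ^ M : ℕ) : ℤ), ((2 ^ M : ℕ) : ℤ) • z = 0 :=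
    zsmul_galH1Torsion_eq_zero _ _
  haveI hCfin : Finite C :=
    (finite_closure_range_of_zsmul_eq_zero gens (q := 2 ^ M) (pow_ne_zero M two_ne_zero)
      hkill).to_subtype
  obtain ⟨ι, hι, g, hgind, hggen⟩ := exists_indep_generators (G := C)
  set xs : ι → galH1Torsion (W.baseChange K) ((2 ^ M : ℕ) : ℤ) :=
    fun i ↦ (g i : galH1Torsion (W.baseChange K) ((2 ^ M : ℕ) : ℤ)) with hxs
  -- orders `2^{e_i}`
  have hgq : ∀ i, ((2 ^ M : ℕ) : ℤ) • g i = 0 := fun i ↦ Subtype.ext (by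
    rw [AddSubgroupClass.coe_zsmul, ZeroMemClass.coe_zero]; exact hkill _)
  have hord : ∀ i, ∃ e : ℕ, e ≤ M ∧ addOrderOf (g i) = 2 ^ e := by
    intro i
    have hdvd : addOrderOf (g i) ∣ 2 ^ M := by
      apply addOrderOf_dvd_of_nsmul_eq_zero
      rw [← natCast_zsmul]
      exact_mod_cast hgq i
    exact (Nat.dvd_prime_pow Nat.prime_two).mp hdvd
  choose e heM he using hord
  have hexg : ∀ i, ((2 : ℤ) ^ e i) • g i = 0 := by
    intro i
    have h := addOrderOf_nsmul_eq_zero (g i)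
    rw [he i, ← natCast_zsmul] at h
    exact_mod_cast h
  have hex : ∀ i, ((2 : ℤ) ^ e i) • xs i = 0 := fun i ↦ by
    have h := congrArg Subtype.val (hexg i)
    rwa [AddSubgroupClass.coe_zsmul, ZeroMemClass.coe_zero] at h
  have hind : ∀ a : ι → ℤ, ∑ i, a i • xs i = 0 → ∀ i, ((2 : ℤ) ^ e i) ∣ a i := by
    intro a ha i
    have ha' : ∑ i, a i • g i = 0 := by
      apply Subtype.ext
      rw [AddSubmonoidClass.coe_finsetSum, ZeroMemClass.coe_zero]
      simp only [AddSubgroupClass.coe_zsmul]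
      simpa only [hxs] using ha
    have := hgind a ha' i
    rw [he i] at this
    exact_mod_cast this
  -- every class of `C` is a combination of the `gens`; `hres` for `xs`
  have hres : ∀ a : ι → ℤ, (∀ ρ ∈ torsionFixing (W.baseChange K) ((2 ^ M : ℕ) : ℤ),
      h1Eval (W.baseChange K) ((2 ^ M : ℕ) : ℤ) (∑ i, a i • xs i) ρ = 0) → ∑ i, a i • xs i = 0 := by
    intro a ha
    have hmem : ∑ i, a i • xs i ∈ C :=
      AddSubgroup.sum_mem _ fun i _ ↦ AddSubgroup.zsmul_mem _ (g i).2 _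
    obtain ⟨b', hb'⟩ := exists_sum_eq_of_mem_closure_range gens hmem
    rw [← hb']
    exact hvis b' fun ρ hρ ↦ by rw [hb']; exact ha ρ hρ
  -- ### the two-ray character on `C` killing `C₀ = ⟨gens i : i ≠ i₁, i₂⟩`
  set C₀ : AddSubgroup (galH1Torsion (W.baseChange K) ((2 ^ M : ℕ) : ℤ)) :=
    AddSubgroup.closure (gens '' {i | i ≠ i₁ ∧ i ≠ i₂}) with hC₀
  have hgensC : ∀ i, gens i ∈ C := fun i ↦ AddSubgroup.subset_closure (Set.mem_range_self i)
  obtain ⟨χ, hχK, hχ₁, hχ₂⟩ := exists_addMonoidHom_unitAddCircle_two_rays (G := C) (p := 2)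
    (M := M) (fun z ↦ Subtype.ext (by
      rw [AddSubgroupClass.coe_zsmul, ZeroMemClass.coe_zero]
      exact_mod_cast hkill (z : galH1Torsion (W.baseChange K) ((2 ^ M : ℕ) : ℤ))))
    (C₀.addSubgroupOf C) ⟨gens i₁, hgensC i₁⟩ ⟨gens i₂, hgensC i₂⟩
  -- integer targets `coef i / 2^M = χ (g i)`
  have hχq : ∀ i, (2 ^ M) • χ (g i) = 0 := fun i ↦ by
    rw [← map_nsmul, ← natCast_zsmul]
    have : ((2 ^ M : ℕ) : ℤ) • g i = 0 := hgq i
    rw [this, map_zero]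
  choose cf hcf using fun i ↦ exists_coe_div_eq_of_nsmul_eq_zero (hχq i)
  set coef : ι → ℤ := fun i ↦ (cf i : ℤ) with hcoef_def
  -- reading `χ` on a combination of the basis
  have hχsum : ∀ a : ι → ℤ,
      χ (∑ i, a i • g i) =
        ((((∑ i, a i * coef i : ℤ) : ℝ) / ((2 ^ M : ℕ) : ℝ)) : UnitAddCircle) := by
    intro a
    rw [map_sum, Int.cast_sum, Finset.sum_div, QuotientAddGroup.mk_sum]
    refine Finset.sum_congr rfl fun i _ ↦ ?_
    rw [map_zsmul, ← hcf i, ← QuotientAddGroup.mk_zsmul, hcoef_def]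
    congr 1
    push_cast
    ring
  have hχzero : ∀ a : ι → ℤ, χ (∑ i, a i • g i) = 0 ↔ (2 : ℤ) ^ M ∣ ∑ i, a i * coef i := by
    intro a
    rw [hχsum, coe_div_eq_zero_iff_dvd]
  have hcoef : ∀ i, ((2 : ℤ) ^ e i * coef i) • θ P₀ = 0 := by
    intro i
    rw [hAP]
    have h1 : ∑ i', (Pi.single i ((2 : ℤ) ^ e i) : ι → ℤ) i' • g i' = ((2 : ℤ) ^ e i) • g i := by
      rw [Finset.sum_eq_single i (fun i' _ hi' ↦ by rw [Pi.single_eq_of_ne hi', zero_smul])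
        (fun h ↦ absurd (Finset.mem_univ i) h), Pi.single_eq_same]
    have h2 : ∑ i', (Pi.single i ((2 : ℤ) ^ e i) : ι → ℤ) i' * coef i' = (2 : ℤ) ^ e i * coef i := by
      rw [Finset.sum_eq_single i (fun i' _ hi' ↦ by rw [Pi.single_eq_of_ne hi', zero_mul])
        (fun h ↦ absurd (Finset.mem_univ i) h), Pi.single_eq_same]
    have h0 := (hχzero (Pi.single i ((2 : ℤ) ^ e i))).mp (by rw [h1, hexg, map_zero])
    rwa [h2] at h0
  -- ### Step B (character form) and Steps C–H (criterion, test family `gens`)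
  obtain ⟨ρ, hρT, -, hchar⟩ := exists_h1Eval_conj_mul_character_signStable W ht hinv h2n hS hCe
    hPM hfree xs e hex hind hres coef hcoef
  obtain ⟨ℓ, hbℓ, hℓ, hℓN, hℓD, hℓ2, hprime, h32, hdvd1, hdvd2, m₀, hm₀, hloc⟩ :=
    exists_kolyvaginPrime_gt_two_criterion (N := N) Automorphic.chebotarev_artinRep_of_galoisSide
      hK hM hc₀ hc gens hρT b
  have hidx : M ≤ Zhang2014.kolyvaginIndex W 2 ℓ :=
    Zhang2014.le_kolyvaginIndex_iff.mpr ⟨hdvd1, hdvd2⟩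
  -- `m₀ ∈ 𝒩(xs)` (every `xs i` is a combination of the `gens`)
  have hm₀T : m₀ ∈ torsionFixing (W.baseChange K) ((2 ^ M : ℕ) : ℤ) := hm₀.1
  have hm₀xs : m₀ ∈ evalKer (W.baseChange K) ((2 ^ M : ℕ) : ℤ) xs := by
    refine (mem_evalKer_iff _ _).mpr ⟨hm₀T, fun i ↦ ?_⟩
    obtain ⟨b', hb'⟩ := exists_sum_eq_of_mem_closure_range gens (g i).2
    change h1Eval (W.baseChange K) ((2 ^ M : ℕ) : ℤ) (g i : galH1Torsion (W.baseChange K) ((2 ^ M : ℕ) : ℤ)) m₀ = 0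
    rw [← hb', h1Eval_sum _ _ _ _ hm₀T]
    refine Finset.sum_eq_zero fun k _ ↦ ?_
    rw [h1Eval_zsmul _ _ _ _ hm₀T, ((mem_evalKer_iff _ _).mp hm₀).2 k, smul_zero]
  -- the Frobenius-type element and the kernel criterion for a class of `C`
  set F := ht.conjGalCMH (ρ * m₀) * (ρ * m₀) with hF
  have hρm : ρ * m₀ ∈ torsionFixing (W.baseChange K) ((2 ^ M : ℕ) : ℤ) := mul_mem hρT hm₀T
  have hFT : F ∈ torsionFixing (W.baseChange K) ((2 ^ M : ℕ) : ℤ) :=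
    mul_mem (ht.conjGalCMH_mem_torsionFixing W hinv _ hρm) hρm
  -- KEY: for `z = ∑ a_i xs_i ∈ C` pure of sign `s`: `[z, F] = 0 ↔ χ z = 0`
  have hkey : ∀ (a : ι → ℤ) (s : ℤ), (s = 1 ∨ s = -1) →
      conjAct W c ((2 ^ M : ℕ) : ℤ) (∑ i, a i • xs i) = s • ∑ i, a i • xs i →
      (h1Eval (W.baseChange K) ((2 ^ M : ℕ) : ℤ) (∑ i, a i • xs i) F = 0 ↔ χ (∑ i, a i • g i) = 0) := by
    intro a s hs hpure
    rw [hF, hchar m₀ hm₀xs a s hs hpure, hAP, hχzero]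
  -- every `gens k` in the basis
  have hrepr : ∀ k, ∃ a : ι → ℤ, (∑ i, a i • g i = ⟨gens k, hgensC k⟩) ∧
      ∑ i, a i • xs i = gens k := by
    intro k
    obtain ⟨a, ha⟩ := hggen ⟨gens k, hgensC k⟩
    refine ⟨a, ha.symm, ?_⟩
    have := congrArg Subtype.val ha
    rw [AddSubmonoidClass.coe_finsetSum] at this
    simp only [AddSubgroupClass.coe_zsmul] at this
    simpa only [hxs] using this.symm
  -- ### assembly
  refine ⟨ℓ, hbℓ, h32, ⟨hℓ, hℓN, hℓD, hℓ2, hprime, lt_of_lt_of_le (by omega) hidx⟩, hidx,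
    fun i hi₁ hi₂ v hv ↦ ?_, fun k hk v hv j ↦ ?_⟩
  · -- `i ∉ {i₁, i₂}`: `gens i ∈ C₀`, so `χ = 0` there, so `[gens i, F] = 0`, so locally trivial
    obtain ⟨a, haC, haV⟩ := hrepr i
    have hmemK : (⟨gens i, hgensC i⟩ : C) ∈ C₀.addSubgroupOf C :=
      AddSubgroup.mem_addSubgroupOf.mpr (AddSubgroup.subset_closure ⟨i, ⟨hi₁, hi₂⟩, rfl⟩)
    have hχ0 : χ (∑ i', a i' • g i') = 0 := by rw [haC]; exact hχK _ hmemK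
    have hpure : conjAct W c ((2 ^ M : ℕ) : ℤ) (∑ i', a i' • xs i') = sgn i • ∑ i', a i' • xs i' := by
      rw [haV, hτs]
    have h0 : h1Eval (W.baseChange K) ((2 ^ M : ℕ) : ℤ) (∑ i', a i' • xs i') F = 0 :=
      (hkey a _ (hsgn i) hpure).mpr hχ0
    rw [haV] at h0
    have := (hloc i v hv 0).mpr (by rw [pow_zero, one_smul]; exact h0)
    rwa [pow_zero, one_smul] at this
  · -- the rays `2^j gens k`, `k ∈ {i₁, i₂}`
    obtain ⟨a, haC, haV⟩ := hrepr k
    have hsum : ∑ i, (((2 : ℤ) ^ j) * a i) • xs i = ((2 : ℤ) ^ j) • gens k := by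
      rw [← haV, ← zsmulAddGroupHom_apply, map_sum]
      exact Finset.sum_congr rfl fun i _ ↦ by rw [zsmulAddGroupHom_apply, smul_smul]
    have hsumC : ∑ i, (((2 : ℤ) ^ j) * a i) • g i = ((2 : ℤ) ^ j) • (⟨gens k, hgensC k⟩ : C) := by
      rw [← haC, ← zsmulAddGroupHom_apply, map_sum]
      exact Finset.sum_congr rfl fun i _ ↦ by rw [zsmulAddGroupHom_apply, smul_smul]
    have hpure : conjAct W c ((2 ^ M : ℕ) : ℤ) (∑ i, (((2 : ℤ) ^ j) * a i) • xs i) =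
        sgn k • ∑ i, (((2 : ℤ) ^ j) * a i) • xs i := by
      rw [hsum, map_zsmul, hτs, smul_comm]
    -- local ↔ `[2^j gens k, F] = 0` ↔ `χ (2^j gens k) = 0` ↔ `2^j gens k ∈ C₀`
    rw [hloc k v hv j, ← h1Eval_zsmul _ _ _ _ hFT, ← hsum, hkey _ _ (hsgn k) hpure, hsumC]
    have hray : χ (((2 : ℤ) ^ j) • (⟨gens k, hgensC k⟩ : C)) = 0 ↔
        ((2 : ℤ) ^ j) • (⟨gens k, hgensC k⟩ : C) ∈ C₀.addSubgroupOf C := by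
      rcases hk with rfl | rfl
      · exact hχ₁ j
      · exact hχ₂ j
    rw [hray, AddSubgroup.mem_addSubgroupOf, AddSubgroupClass.coe_zsmul, ← hsum]

end Summit.BirchSwinnertonDyer.BirchSwinnertonDyer.Theorems.GenusExact

end
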